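import Summits.BirchSwinnertonDyer.BirchSwinnertonDyer.Theorems.GenusKolyvaginAtTwoVisiblePairAtTwoKolyvaginClassSign
import Summits.BirchSwinnertonDyer.BirchSwinnertonDyer.Theorems.GenusKolyvaginAtTwoVisiblePairAtTwoKolPrimeZhang
import Summits.BirchSwinnertonDyer.BirchSwinnertonDyer.Theorems.GenusKolyvaginAtTwoEquivariantKolyvaginExactAtTwoEigenClassesFinite
import HarnessLib

/-!
# Route `GenusKolyvaginAtTwo`, LINE 6, KEY crux Q3 (inner statement of stmt-BirchSwinnertonDyer-22137):
# the DESCENDED KOLYVAGIN CLASSES of the ℚ-pair instance — `c₁(m) ∈ H¹(ℚ, E[2^M])`, `c₂(m) ∈ H¹(ℚ, E^{(d_K)}[2^M])`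
# with `res c₁(m) = c_M(m)`, `ψ(res c₂(m)) = c_M(m)` — CONSTRUCTED from the Heegner data (fields `c₁`, `c₂`, `cK`,
# `res_c₁`, `res_c₂` of `VisiblePairAtTwo.Input`)

Helper (seat `bsd-line-gk2-p3` g13; `--supports` the crux, closes nothing). The record `Input` (p638903) displays
classes `c₁ m`, `c₂ m`, `cK m` with the descent identities `res (c₁ m) = cK m` (even depth) and
`hPsiKT (res (c₂ m)) = cK m` (odd depth). For the crux these are Kolyvagin's classes: `cK m := c_M(m) = d_m.kolyvaginClass 2 M`
for Kolyvagin–Heegner data `d_m` at every `m ∈ KolSupp (kolPrime W K M)`, and `c₁`/`c₂` their UNIQUE descents to `ℚ`,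
which exist because `c_M(m)` is `τ`-eigen with sign `−w(E)·(−1)^{#primes of m}` (Gross Prop. 5.4 AT `2`,
`KolyvaginClassSign.sign_conjAct_kolyvaginClass_two`, p647685) and `E(K)[2^M] = 0` (`ρ̄_{E,2}` onto;
`EigenClassesFinite.existsUnique_resTorsion_eq_of_conjAct_eq` / `…_hPsiKT_…_of_conjAct_eq_neg`, p634896), the instance's
primes being Zhang–Kolyvagin primes (`kolSupp_zhang_of_kolSupp_kolPrime`, p648403):

* `exists_descent_of_heegnerData` — **for any family `dat` of Kolyvagin–Heegner data on `KolSupp (kolPrime W K M)` there are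
  `c₁ : ℕ → H¹(ℚ, E[2^M])`, `c₂ : ℕ → H¹(ℚ, E^{(d_K)}[2^M])` with `res (c₁ m) = c_M(m)` whenever the sign
  `−w(E)·(−1)^{#primes of m}` is `+1` and `hPsiKT (res (c₂ m)) = c_M(m)` whenever it is `−1`**;
* `exists_descent_of_heegnerData_of_rootNumber_eq_neg_one` — for `w(E) = −1` (the member whose `+`-part carries the Heegner
  class): the identities at EVEN resp. ODD depth — LITERALLY the fields `res_c₁`, `res_c₂` of `Input` for
  `cK m := c_M(m)` (`dite` on `KolSupp`);
* `exists_heegnerData_family` — such a family `dat` EXISTS on the habitat (Gross's CM data at every square-free product of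
  inert primes, `nonempty_kolyvaginHeegnerData_of_grossCM` with the two discharged CM facts; `4N ∣ β² − d_K` from any datum).

THEOREMS ONLY (no definition, no named fact, no `sorry`, standard axioms). Nothing about Kolyvagin's conjecture at `2` or BSD
is asserted; the K-level inputs of `Input` (`rel` = Q2, Lemma 4.3 over `K`, (H2)) remain displayed.

References: [GrossLMS1991] §4 (4.4)–(4.6), §5 (5.1), Prop. 5.4; [McCallumLMS1991] §4 (6), §5 (p. 303); [Kolyvagin1989Izv] §3
(the pair `(E, E^D)`).
-/

set_option autoImplicit false
set_option linter.dupNamespace false -- tree convention: `Summit.BirchSwinnertonDyer.BirchSwinnertonDyer.Theorems` (summit = sub-problem)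

noncomputable section

open scoped Classical

namespace Summit.BirchSwinnertonDyer.BirchSwinnertonDyer.Theorems.GenusExact.VisiblePairAtTwo

open WeierstrassCurve NumberField IsDedekindDomain Field Rat.HeightOneSpectrum
open Literature.NumberTheory.EllipticCurves Literature.NumberTheory.GaloisRepresentations
open Literature.NumberTheory.EllipticCurves.KolyvaginDescent Literature.NumberTheory.EllipticCurves.ModularForms
open Summit.BirchSwinnertonDyer.BirchSwinnertonDyer.Theorems.GenusExact.EigenClassesFinite
open Summit.BirchSwinnertonDyer.BirchSwinnertonDyer.Theorems.GenusExact.KolyvaginClassSign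

variable (W : WeierstrassCurve ℚ) [W.IsElliptic] [W.IsGloballyMinimal] [NeZero (W.conductorNorm ℤ)]
  (K : Type) [Field K] [NumberField K] (M : ℕ) {θ : K} (hθ : θ ∉ Set.range (algebraMap ℚ K))
  (hθsq : θ ^ 2 = algebraMap ℚ K ((NumberField.discr K : ℤ) : ℚ))

/-- `d_K` odd ⟹ `d_K ≠ −4`. [folklore] -/
theorem discr_ne_neg_four_of_odd (hodd : Odd (NumberField.discr K)) : NumberField.discr K ≠ -4 := by
  rintro h
  rcases hodd with ⟨k, hk⟩
  omega

/-- **The descended Kolyvagin classes of the ℚ-pair, from the Heegner data.** On the habitat (`E` globally minimal,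
`ρ̄_{E,2}` onto, `K = ℚ(θ)` imaginary quadratic with `θ² = d_K` odd `≠ −3`, every `p ∣ N_E` split in `K`, `M ≥ 1`), for any
family `dat` of Kolyvagin–Heegner data on the square-free products of the instance's Kolyvagin primes there are
`c₁ : ℕ → H¹(ℚ, E[2^M])` and `c₂ : ℕ → H¹(ℚ, E^{(d_K)}[2^M])` with `res (c₁ m) = c_M(m)` when
`−w(E)·(−1)^{#primes of m} = 1` and `hPsiKT (res (c₂ m)) = c_M(m)` when it is `−1` (sign law at `2` + unique `±` descent).
[cite: GrossLMS1991, §5 (5.1) and Prop. 5.4] [cite: McCallumLMS1991, §5 (p. 303)] -/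
theorem exists_descent_of_heegnerData (hK : IsImaginaryQuadratic K) (hodd : Odd (NumberField.discr K))
    (hD3 : NumberField.discr K ≠ -3) (hH : SatisfiesHeegnerHypothesis (W.conductorNorm ℤ) K)
    (hs : W.HasSurjectiveModNGaloisRep 2) (hM : 1 ≤ M)
    (Dt : ModularParametrizationData W (W.conductorNorm ℤ)) (β : ℤ) (ι : K →+* ℂ)
    (dat : ∀ m : ℕ, KolSupp (kolPrime W K M) m → KolyvaginHeegnerData Dt β ι m) :
    ∃ (c₁ : ℕ → galH1Torsion W (lvl M)) (c₂ : ℕ → galH1Torsion (twin W K) (lvl M)),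
      (∀ (m : ℕ) (hm : KolSupp (kolPrime W K M) m), -W.rootNumber * (-1) ^ m.primeFactors.card = 1 →
        resTorsion W K (lvl M) (c₁ m) = (dat m hm).kolyvaginClass Nat.prime_two M) ∧
      ∀ (m : ℕ) (hm : KolSupp (kolPrime W K M) m), -W.rootNumber * (-1) ^ m.primeFactors.card = -1 →
        hPsiKT W K hθ hθsq (lvl M) (resTorsion (twin W K) K (lvl M) (c₂ m)) =
          (dat m hm).kolyvaginClass Nat.prime_two M := by
  have h2 := hK.1
  have hD4 := discr_ne_neg_four_of_odd K hodd
  have hs1 : W.HasSurjectiveModNGaloisRep ((2 : ℤ) ^ 1) := by rwa [pow_one]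
  have hL := forall_zsmul_two_pow_baseChange_eq_zero_of_hasSurjectiveModNGaloisRep_two W K h2 hs M
  have hτ := sigmaQ_ne_one K h2 hθ hθsq
  -- the sign law at `2` for the class of each datum
  have hsign : ∀ (m : ℕ) (hm : KolSupp (kolPrime W K M) m),
      conjAct W (sigmaQ K h2 hθ hθsq) (lvl M) ((dat m hm).kolyvaginClass Nat.prime_two M) =
        (-W.rootNumber * (-1) ^ m.primeFactors.card) • (dat m hm).kolyvaginClass Nat.prime_two M := by
    intro m hm
    obtain ⟨hsq, hz⟩ := kolSupp_zhang_of_kolSupp_kolPrime W M h2 hM hm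
    exact (sign_conjAct_kolyvaginClass_two hK hD3 hD4 hodd hH hs1 (sigmaQ K h2 hθ hθsq) hτ Dt β ι hsq hM hz
      (dat m hm)).2
  -- `+` descents
  have h₁ : ∀ m : ℕ, ∃ u : galH1Torsion W (lvl M), ∀ hm : KolSupp (kolPrime W K M) m,
      -W.rootNumber * (-1) ^ m.primeFactors.card = 1 →
        resTorsion W K (lvl M) u = (dat m hm).kolyvaginClass Nat.prime_two M := by
    intro m
    by_cases h : ∃ hm : KolSupp (kolPrime W K M) m, -W.rootNumber * (-1) ^ m.primeFactors.card = 1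
    · obtain ⟨hm, he⟩ := h
      have hy := hsign m hm
      rw [he, one_smul] at hy
      obtain ⟨u, hu, -⟩ := existsUnique_resTorsion_eq_of_conjAct_eq W K h2 hθ hθsq (lvl M) hL hy
      exact ⟨u, fun hm' he' ↦ hu⟩
    · exact ⟨0, fun hm he ↦ (h ⟨hm, he⟩).elim⟩
  -- `−` descents
  have h₂ : ∀ m : ℕ, ∃ y : galH1Torsion (twin W K) (lvl M), ∀ hm : KolSupp (kolPrime W K M) m,
      -W.rootNumber * (-1) ^ m.primeFactors.card = -1 →
        hPsiKT W K hθ hθsq (lvl M) (resTorsion (twin W K) K (lvl M) y) =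
          (dat m hm).kolyvaginClass Nat.prime_two M := by
    intro m
    by_cases h : ∃ hm : KolSupp (kolPrime W K M) m, -W.rootNumber * (-1) ^ m.primeFactors.card = -1
    · obtain ⟨hm, he⟩ := h
      have hy := hsign m hm
      rw [he, neg_one_zsmul] at hy
      obtain ⟨y, hy', -⟩ := existsUnique_hPsiKT_resTorsion_eq_of_conjAct_eq_neg W K h2 hθ hθsq (lvl M) hL hy
      exact ⟨y, fun hm' he' ↦ hy'⟩
    · exact ⟨0, fun hm he ↦ (h ⟨hm, he⟩).elim⟩
  choose c₁ hc₁ using h₁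
  choose c₂ hc₂ using h₂
  exact ⟨c₁, c₂, fun m hm he ↦ hc₁ m hm he, fun m hm he ↦ hc₂ m hm he⟩

/-- **The fields `res_c₁`, `res_c₂` of `Input` for `cK m := c_M(m)`, when `w(E) = −1`** (the member carrying the Heegner class
in its `+`-part; then the sign of `c_M(m)` is `(−1)^{#primes of m}`): with
`cK m := if h : KolSupp (kolPrime W K M) m then (dat m h).kolyvaginClass 2 M else 0`, there are `c₁`, `c₂` with
`res (c₁ m) = cK m` at even depth and `hPsiKT (res (c₂ m)) = cK m` at odd depth — LITERALLY `Input.res_c₁`, `Input.res_c₂`.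
[cite: GrossLMS1991, §5 Prop. 5.4] [cite: Kolyvagin1989Izv, §3 (the pair `(E, E^D)`)] -/
theorem exists_descent_of_heegnerData_of_rootNumber_eq_neg_one (hK : IsImaginaryQuadratic K)
    (hodd : Odd (NumberField.discr K)) (hD3 : NumberField.discr K ≠ -3)
    (hH : SatisfiesHeegnerHypothesis (W.conductorNorm ℤ) K) (hs : W.HasSurjectiveModNGaloisRep 2) (hM : 1 ≤ M)
    (hw : W.rootNumber = -1)
    (Dt : ModularParametrizationData W (W.conductorNorm ℤ)) (β : ℤ) (ι : K →+* ℂ)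
    (dat : ∀ m : ℕ, KolSupp (kolPrime W K M) m → KolyvaginHeegnerData Dt β ι m) :
    ∃ (c₁ : ℕ → galH1Torsion W (lvl M)) (c₂ : ℕ → galH1Torsion (twin W K) (lvl M)),
      (∀ m, KolSupp (kolPrime W K M) m → Even m.primeFactors.card →
        resTorsion W K (lvl M) (c₁ m) =
          (if h : KolSupp (kolPrime W K M) m then (dat m h).kolyvaginClass Nat.prime_two M else 0)) ∧
      ∀ m, KolSupp (kolPrime W K M) m → Odd m.primeFactors.card →
        hPsiKT W K hθ hθsq (lvl M) (resTorsion (twin W K) K (lvl M) (c₂ m)) =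
          (if h : KolSupp (kolPrime W K M) m then (dat m h).kolyvaginClass Nat.prime_two M else 0) := by
  obtain ⟨c₁, c₂, h₁, h₂⟩ := exists_descent_of_heegnerData W K M hθ hθsq hK hodd hD3 hH hs hM Dt β ι dat
  refine ⟨c₁, c₂, fun m hm hev ↦ ?_, fun m hm hod ↦ ?_⟩
  · rw [dif_pos hm]
    exact h₁ m hm (by rw [hw, hev.neg_one_pow]; norm_num)
  · rw [dif_pos hm]
    exact h₂ m hm (by rw [hw, hod.neg_one_pow]; norm_num)

/-- **A family of Kolyvagin–Heegner data on the instance's square-free products EXISTS** on the habitat, over any frame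
`(Dt, β, ι)` with `4 N_E ∣ β² − d_K` (e.g. from one datum, `KolyvaginHeegnerData.dvd_sq_sub`): Gross's CM construction at
every square-free product of primes inert in `K` (`nonempty_kolyvaginHeegnerData_of_grossCM`, the two CM facts discharged),
the instance's primes being inert (`forall_span_isPrime_of_kolSupp_kolPrime`). [cite: GrossLMS1991, §3 (pp. 238–239), §4 (4.1)] -/
theorem exists_heegnerData_family (hK : IsImaginaryQuadratic K) (hH : SatisfiesHeegnerHypothesis (W.conductorNorm ℤ) K)
    (Dt : ModularParametrizationData W (W.conductorNorm ℤ)) (β : ℤ) (ι : K →+* ℂ)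
    (hβ : (4 * (W.conductorNorm ℤ : ℕ) : ℤ) ∣ β ^ 2 - NumberField.discr K) :
    Nonempty (∀ m : ℕ, KolSupp (kolPrime W K M) m → KolyvaginHeegnerData Dt β ι m) := by
  have hCM1 : phi_heegnerPointOfConductor_mem_range_map_ringClassField (W.conductorNorm ℤ) W K :=
    phi_heegnerPointOfConductor_mem_range_map_ringClassField_holds (W.conductorNorm ℤ) W K
  have hCM2 : exists_generator_ringClassGalOver K := exists_generator_ringClassGalOver_holds
  exact ⟨fun m hm ↦ (BirchSwinnertonDyer.Theorems.nonempty_kolyvaginHeegnerData_of_grossCM hCM1 hCM2 hK hH Dt β ι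
    hβ hm.1 (forall_span_isPrime_of_kolSupp_kolPrime W M hK.1 hm)).some⟩

end Summit.BirchSwinnertonDyer.BirchSwinnertonDyer.Theorems.GenusExact.VisiblePairAtTwo

end
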